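import Literature.Analysis.FluidPDE.PineauVicolRSSHolds
import HarnessLib

/-!
# Crux `NoTypeIBlowup` (stmt-NavierStokesRegularity-1217), line `killing-twisted-bernoulli-solitons`:
  stub W3 `rssCompact_eq_pvAnsatz_of_symmetric` (an RSS-symmetric field is the ansatz of its `t = −1` slice)

In the compactness argument for the openness in `α` of the Pineau–Vicol RSS Liouville property the
limit field `v` inherits the rotated self-similar (RSS) symmetry
`v(t, x) = μ R(θ_μ) v(μ² t, μ R(−θ_μ) x)`, `θ_μ = α · 2 log μ`, for every `μ ≥ 1` and every
`t ≤ −1/4` (`R(θ) = rotZ θ`). This file converts that symmetry into the statement that `v` IS the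
rotated self-similar ansatz field `pvAnsatz α (fun y _ => v (-1) y)` of its own `t = −1` slice on
`t ≤ −1/4` — the RSS analogue of `Literature.Analysis.FluidPDE.ChaeWolf.slice_eq_smul_slice` /
`ChaeWolf.slice_eq_lerayBackward`.

* `RssCompactnessSymmetric.symm_of_pos` — the symmetry extends from `μ ≥ 1` to every `μ > 0` as
  long as both times `t` and `μ² t` are `≤ −1/4` (for `μ < 1` apply the hypothesis with `μ⁻¹ ≥ 1`
  at the time `μ² t` and the point `μ R(−θ_μ) x`, and invert the rotation and the scaling).
* `rssCompact_eq_pvAnsatz_of_symmetric` — take `μ = (√(−t))⁻¹`: then `μ² t = −1` and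
  `2 log μ = −log(−t)`, which is the ansatz (1.7) with `s = −log(−t)`.

Lands `--supports stmt-NavierStokesRegularity-1217`.
-/

noncomputable section

set_option linter.dupNamespace false

namespace Summit.NavierStokesRegularity.NavierStokesRegularity.Theorems

open Literature.Analysis.FluidPDE

namespace RssCompactnessSymmetric

/-- For a field which is rotated-`μ`-self-similar for every `μ ≥ 1` on `t ≤ −1/4`
(`v(t, x) = μ R(θ_μ) v(μ² t, μ R(−θ_μ) x)`, `θ_μ = α · 2 log μ`), the same identity holds for every
`μ > 0` provided both `t ≤ −1/4` and `μ² t ≤ −1/4`. [folklore] -/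
theorem symm_of_pos {α : ℝ} {v : ℝ → EuclideanSpace ℝ (Fin 3) → EuclideanSpace ℝ (Fin 3)}
    (H : ∀ μ : ℝ, 1 ≤ μ → ∀ t ≤ -(1 / 4 : ℝ), ∀ x,
      v t x = μ • rotZ (α * (2 * Real.log μ)) (v (μ ^ 2 * t) (μ • rotZ (-(α * (2 * Real.log μ))) x)))
    {μ : ℝ} (hμ : 0 < μ) {t : ℝ} (ht : t ≤ -(1 / 4 : ℝ)) (hs : μ ^ 2 * t ≤ -(1 / 4 : ℝ))
    (x : EuclideanSpace ℝ (Fin 3)) :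
    v t x = μ • rotZ (α * (2 * Real.log μ)) (v (μ ^ 2 * t) (μ • rotZ (-(α * (2 * Real.log μ))) x)) := by
  rcases le_or_gt 1 μ with h1 | h1
  · exact H μ h1 t ht x
  · -- `μ < 1`: apply the hypothesis with `μ⁻¹ ≥ 1` at the time `μ² t` and the point `μ R(−θ) x`
    -- rotations about the axis are linear (`rotZL`), hence commute with scalings
    have hzs : ∀ (φ a : ℝ) (z : EuclideanSpace ℝ (Fin 3)), rotZ φ (a • z) = a • rotZ φ z :=
      fun φ a z => by rw [← rotZL_apply, map_smul, rotZL_apply]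
    have hμ' : 1 ≤ μ⁻¹ := (one_le_inv₀ hμ).2 h1.le
    have hθ : α * (2 * Real.log μ⁻¹) = -(α * (2 * Real.log μ)) := by
      rw [Real.log_inv]; ring
    have key := H μ⁻¹ hμ' (μ ^ 2 * t) hs (μ • rotZ (-(α * (2 * Real.log μ))) x)
    have e1 : μ⁻¹ ^ 2 * (μ ^ 2 * t) = t := by
      field_simp
    have e2 : μ⁻¹ • rotZ (α * (2 * Real.log μ)) (μ • rotZ (-(α * (2 * Real.log μ))) x) = x := by
      rw [hzs, smul_smul, inv_mul_cancel₀ hμ.ne', one_smul, ← rotZ_add, add_neg_cancel, rotZ_zero]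
    rw [hθ, neg_neg, e1, e2] at key
    rw [key, hzs, smul_smul, mul_inv_cancel₀ hμ.ne', one_smul, ← rotZ_add, add_neg_cancel,
      rotZ_zero]

end RssCompactnessSymmetric

/-- **An RSS-symmetric field on `t ≤ −1/4` is the rotated self-similar ansatz of its `t = −1`
slice.** If `v(t, x) = μ R(α · 2 log μ) v(μ² t, μ R(−α · 2 log μ) x)` for every `μ ≥ 1`,
`t ≤ −1/4` and `x`, then `v(t, x) = pvAnsatz α (fun y _ => v (-1) y) t x` for `t ≤ −1/4`, i.e.
`v(t, x) = (−t)^{−1/2} R(αs) v(−1, R(−αs) x/√(−t))` with `s = −log(−t)` (Pineau–Vicol (1.7)). [folklore] -/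
theorem rssCompact_eq_pvAnsatz_of_symmetric :
    ∀ (α : ℝ) (v : ℝ → EuclideanSpace ℝ (Fin 3) → EuclideanSpace ℝ (Fin 3)),
      (∀ μ : ℝ, 1 ≤ μ → ∀ t ≤ -(1 / 4 : ℝ), ∀ x,
        v t x = μ • Literature.Analysis.FluidPDE.rotZ (α * (2 * Real.log μ))
          (v (μ ^ 2 * t) (μ • Literature.Analysis.FluidPDE.rotZ (-(α * (2 * Real.log μ))) x))) →
      ∀ t ≤ -(1 / 4 : ℝ), ∀ x,
        v t x = Literature.Analysis.FluidPDE.pvAnsatz α (fun y _ => v (-1) y) t x := by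
  intro α v H t ht x
  have ht0 : 0 < -t := by linarith
  have hr : 0 < Real.sqrt (-t) := Real.sqrt_pos.2 ht0
  have hμ : 0 < (Real.sqrt (-t))⁻¹ := inv_pos.2 hr
  have e1 : (Real.sqrt (-t))⁻¹ ^ 2 * t = -1 := by
    rw [inv_pow, Real.sq_sqrt ht0.le, inv_neg, neg_mul, inv_mul_cancel₀ (by linarith : t < 0).ne]
  have e2 : 2 * Real.log (Real.sqrt (-t))⁻¹ = -Real.log (-t) := by
    rw [Real.log_inv, Real.log_sqrt ht0.le]
    ring
  have key := RssCompactnessSymmetric.symm_of_pos H hμ ht (by rw [e1]; norm_num) x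
  rw [e1, e2] at key
  -- the inner point: `μ • R(−θ) x = R(−θ) (μ • x)` by linearity of the rotation (`rotZL`)
  rw [key, ← rotZL_apply (-(α * -Real.log (-t))) x, ← map_smul, rotZL_apply]
  simp only [pvAnsatz]

end Summit.NavierStokesRegularity.NavierStokesRegularity.Theorems

end
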